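/-
Copyright (c) 2026. All rights reserved.
Released under Apache 2.0 license as described in the file LICENSE.
-/
import Literature.NumberTheory.Weil1964.ArchDualPairThetaMajorantsInrConj
import Literature.NumberTheory.Automorphic.QuadExtPlacesAbove
import HarnessLib

/-!
# Lemme 5 for the second factor in a conjugated polarisation — `E` totally complex, `W` a PLANE: no side condition

Sequel of `ArchDualPairThetaMajorantsInrConj` (Weil's Lemme 5 [Weil1964, Chap. III n° 41 p. 194] for the family
`u ↦ ω_ψ(q · s_pair(1, u) · q⁻¹)` of the second factor `1 × U(W)` of the diagonal unitary dual pair of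
[GelbartRogawski1991] §3.1, read in a conjugated polarisation).  Its §1 head
`exists_piSchwartzBruhat_dominating_omega_conj_pairSplitting_inr_of_signs` is stated for a GENERIC quadratic
extension `E/F` of a totally real field and carries four book-keeping binders: a choice `wOf` of a `c`-stable complex
place of `E` over every real place of `F` (`hw`, `hover`), the non-triviality `c ≠ 1`, and the real-rank-`≤ 1` sign
fact `hrk` on `t_W`.  This file discharges all four in the situation the Siegel–Weil engine of cell hodgecm-mathlib
meets (F0P4-p05 (g3) census 2026-08-31 05:29:09Z (4), the A6 input adapter `hIMPL_CM` at GENERIC `(F, E)`):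

* `E` totally complex ⇒ every real place of `F` is of type (i) and THE complex place above it is `c`-stable
  (★ `UnitaryGroup.placeAboveOne`, `isTypeOne_of_isTotallyComplex`, `smul_placeAboveOne`, `placeAboveOne_comap`);
* `c δ = -δ`, `δ ≠ 0` ⇒ `c ≠ 1` (characteristic `0`);
* `M = 2` (a hermitian PLANE, e.g. `W ⊕ W⁻` of the doubling method) ⇒ the sign fact holds with `j₀ := 1` at every
  real place (a non-degenerate real binary diagonal form has real rank `≤ 1`), exactly as in §3 of the parent file
  at the CM pin.

Main statement: **`exists_piSchwartzBruhat_dominating_omega_conj_pairSplitting_inr_of_isTotallyComplex_two`** —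
generic `(F, E, c)` with `[IsTotallyReal F] [IsTotallyComplex E]`, ANY diagonal `t_V`, ANY non-degenerate diagonal
`t_W : Fin 2 → F`, ANY continuous compatible splitting `s`, ANY fixed `q ∈ Mp_ψ(𝕎_𝔸)ᶜᵒⁿᵗ`: on every compact
`C ⊆ U(J_W)(𝔸_F)` the functions `ω_ψ(q · s_pair(1, u) · q⁻¹)Φ`, `u ∈ C`, are dominated by ONE real non-negative
`Φ₀ ∈ 𝒮(𝔸_Fⁿ)`.

KERNEL only: no definition, no cited statement enters as a hypothesis.  HC_CM is proved only modulo the printed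
citations until rung 0 closes; nothing here is about Hodge classes.

## References

* [Weil1964] A. Weil, Acta Math. 111 (1964), Chap. III n° 41, Lemme 5 p. 194, Théorème 6 (1) p. 193.
* [Weil1965] A. Weil, Acta Math. 113 (1965), Chap. V n° 47 Lemme 20, n° 50.
* [GelbartRogawski1991] S. Gelbart, J. Rogawski, Invent. Math. 105 (1991), §3.1 Prop. 3.1.1 p. 455.
* [KonnoKonno2007] K. Konno, T. Konno, Kyushu J. Math. 61 (2007), §3.1 (3.1).
* [CasselsFrohlichANT1967] J. W. S. Cassels, A. Fröhlich (eds.), *Algebraic Number Theory* (1967), Ch. II §14.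
-/

noncomputable section

open scoped Matrix Real Classical ComplexConjugate
open Complex NumberField NumberField.InfinitePlace NumberField.mixedEmbedding IsDedekindDomain
open Literature.NumberTheory.Automorphic Literature.NumberTheory.Automorphic.UnitaryGroup
open Literature.RepresentationTheory.HeisenbergGroup

namespace Literature.NumberTheory.Weil1964

/-! ## §1b Generic `E/F` with `E` totally complex, `M = 2` -/

section PairTotallyComplexTwo

variable {F : Type} [Field F] [NumberField F] (E : Type) [Field E] [NumberField E] [Algebra F E] (c : E ≃ₐ[F] E)
  (N : ℕ) {m : ℕ} (e : Fin N × Fin 2 ≃ Fin m)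
  (tV : Fin N → F) (tW : Fin 2 → F) {JV : Matrix (Fin N) (Fin N) E} {JW : Matrix (Fin 2) (Fin 2) E}
  (hJV : JV = (Matrix.diagonal tV).map (algebraMap F E)) (hJW : JW = (Matrix.diagonal tW).map (algebraMap F E))
  [IsTotallyReal F] [Algebra.IsQuadraticExtension F E] {δ : E} (hcδ : c δ = -δ) (hδ : δ ≠ 0) {d : F}
  (hd : δ * δ = algebraMap F E d) (hV : (Matrix.diagonal tV).IsSymm) (hW : (Matrix.diagonal tW).IsSymm)

omit [NumberField F] [IsTotallyReal F] [Algebra.IsQuadraticExtension F E] in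
include hcδ hδ in
/-- an `F`-automorphism of `E` negating a non-zero element is not the identity (characteristic `0`). [folklore] -/
private theorem algEquiv_ne_one_of_apply_eq_neg : c ≠ 1 := by
  rintro rfl
  rw [AlgEquiv.one_apply] at hcδ
  have h2 : (2 : E) * δ = 0 := by linear_combination hcδ
  exact hδ ((mul_eq_zero.1 h2).resolve_left two_ne_zero)

omit [NumberField F] [IsTotallyReal F] in
/-- a non-degenerate real BINARY diagonal form has real rank `≤ 1`: with `j₀ := 1` the sign condition off `j₀` is the
sign of `σ_v(t_W 0) ≠ 0`. [folklore] -/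
private theorem exists_rankLeOne_of_two (hWd : IsUnit (Matrix.diagonal tW).det) (v : {v : InfinitePlace F // v.IsReal}) :
    ∃ j₀ : Fin 2, (∀ j, j ≠ j₀ → 0 < embedding_of_isReal v.2 (tW j)) ∨
      ∀ j, j ≠ j₀ → embedding_of_isReal v.2 (tW j) < 0 := by
  refine ⟨1, ?_⟩
  have h0 : embedding_of_isReal v.2 (tW 0) ≠ 0 := (map_ne_zero _).2 (ne_zero_of_isUnit_det_diagonal hWd 0)
  rcases lt_or_gt_of_ne h0 with h | h
  · refine Or.inr fun j hj => ?_
    fin_cases j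
    · exact h
    · exact absurd rfl hj
  · refine Or.inl fun j hj => ?_
    fin_cases j
    · exact h
    · exact absurd rfl hj

/-- **Lemme 5 for the second factor in a conjugated polarisation, `E` TOTALLY COMPLEX and `W` a hermitian PLANE —
no side condition at all** (generic `(F, E, c)`; ANY diagonal `t_V`, ANY non-degenerate diagonal `t_W : Fin 2 → F`, ANY
continuous compatible splitting `s`, ANY fixed `q ∈ Mp_ψ(𝕎_𝔸)ᶜᵒⁿᵗ`): for every `Φ ∈ 𝒮(𝔸_Fⁿ)` and every compact
`C ⊆ U(J_W)(𝔸_F)` there is ONE real non-negative `Φ₀ ∈ 𝒮(𝔸_Fⁿ)` with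
`‖(ω_ψ(q · s_pair(1, u) · q⁻¹)Φ)(x)‖ ≤ (Φ₀ x).re` for all `u ∈ C` and `x ∈ 𝔸_Fⁿ`.  This is ★
`exists_piSchwartzBruhat_dominating_omega_conj_pairSplitting_inr_of_signs` with its four book-keeping binders
discharged: `wOf := placeAboveOne` (every real place of `F` is of type (i) when `E` is totally complex),
`hw := smul_placeAboveOne`, `hover := placeAboveOne_comap`, `c ≠ 1` from `c δ = -δ ≠ 0`, and `hrk` from `M = 2`.
[cite: Weil1964, Chap. III n° 41, Lemme 5 p. 194]
[cite: Weil1965, Chap. V n° 47, n° 50]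
[cite: GelbartRogawski1991, §3.1 Prop. 3.1.1 p. 455]
[cite: KonnoKonno2007, §3.1 (3.1)]
[cite: CasselsFrohlichANT1967, Ch. II §14] -/
theorem exists_piSchwartzBruhat_dominating_omega_conj_pairSplitting_inr_of_isTotallyComplex_two [IsTotallyComplex E]
    (hVd : IsUnit (Matrix.diagonal tV).det) (hWd : IsUnit (Matrix.diagonal tW).det)
    {s : UnitaryGroup.adelicPair F E c N 2 JV JW →* adelicMpCont F (Fin m)
      (GelbartRogawski1991.UnitaryDualPair.adelicGram F e (Matrix.diagonal tV) (Matrix.diagonal tW))}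
    (hs : (GelbartRogawski1991.UnitaryDualPair.splittingDatum F E c N 2 e JV JW hcδ hδ hd hV hW hVd hWd hJV
      hJW).IsCompatible s)
    (hsc : Continuous s)
    (q : adelicMpCont F (Fin m)
      (GelbartRogawski1991.UnitaryDualPair.adelicGram F e (Matrix.diagonal tV) (Matrix.diagonal tW)))
    (Φ : piSchwartzBruhat F (Fin m)) {C : Set (UnitaryGroup.adelic F E c 2 JW)} (hC : IsCompact C) :
    ∃ Φ₀ : (Fin m → AdeleRing (𝓞 F) F) → ℂ, Φ₀ ∈ piSchwartzBruhat F (Fin m) ∧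
      (∀ x, (Φ₀ x).im = 0 ∧ 0 ≤ (Φ₀ x).re) ∧
        ∀ u ∈ C, ∀ x, ‖((adelicMpCont.omega F (Fin m)
          (GelbartRogawski1991.UnitaryDualPair.adelicGram F e (Matrix.diagonal tV) (Matrix.diagonal tW))
          (q * GelbartRogawski1991.UnitaryDualPair.pairSplitting F E c N 2 e JV JW s (1, u) * q⁻¹) Φ :
            piSchwartzBruhat F (Fin m)) : (Fin m → AdeleRing (𝓞 F) F) → ℂ) x‖ ≤ (Φ₀ x).re :=
  exists_piSchwartzBruhat_dominating_omega_conj_pairSplitting_inr_of_signs E c N 2 e tV tW hJV hJW hcδ hδ hd hV hW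
    (algEquiv_ne_one_of_apply_eq_neg E c hcδ hδ)
    (fun v => placeAboveOne F E ⟨v, isTypeOne_of_isTotallyComplex F E v⟩)
    (fun v => smul_placeAboveOne F E c ⟨v, isTypeOne_of_isTotallyComplex F E v⟩)
    (fun v => placeAboveOne_comap F E ⟨v, isTypeOne_of_isTotallyComplex F E v⟩) hVd hWd
    (exists_rankLeOne_of_two tW hWd) hs hsc q Φ hC

end PairTotallyComplexTwo

end Literature.NumberTheory.Weil1964

end
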